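import Summits.HubbardSuperconductivity.HubbardSuperconductivity.Theorems.AnisotropyChordTransferFibre3N1RowObjQKernel

/-!
# Route `AnisotropyChord` / H0 rotor rung, LEVEL 2 row `N₁`: the OUTER SUMS of `Q̂₁` at the true vector

Object-layer soundness for part 3 (`…N1RowExprQ`), outer region.  With `M(k) = Σ_e|μ_e(k)|²`, `c(k)`, `g(k)`, `E(k)`,
`|c| = 2c_sg + d`, the repaired slope `κ̂′` and `Y, P₂` of `PC0OuterBound` (`m₀ = 13/10`):
* single-sum reductions off the origin (`E g = 1 + λ₂g`): ★ `sum_MK_gres` (`Σ_{k≠0} M g = M_g`), ★ `sum_YP2`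
  (`Σ_{k≠0} (Y + P₂)(|c| + κ̂′g)` in the named sums `S₁, S₂, S₃`, `V`);
* hatted per-momentum values: `eval_M1` (`M1 ↦ t·M(k)`), `eval_acx` (`acx ↦ t(|c| + κ̂′g)`), `eval_YR1` (`YR1 ↦ t(Y + P₂)`);
* hatted full sums: ★ `eval_Q1closedFull` (`↦ t²Σ_{k≠0} M c`, `PC0ClosedExpansion`), ★ `eval_vDfull` (`↦ t²κ̂′Σ_{k≠0} M g`),
  ★ `eval_vYfull` (`↦ t²Σ_{k≠0}(Y + P₂)(|c| + κ̂′g)`).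
Prover seat `hubbard-h0-rotor-p2` g5; helper for piece A = stmt-HubbardSuperconductivity-23918 of rung 19089
(`--supports`, helper class).  Nothing here proves superconductivity in the Hubbard model; helper lemmas of ONE conditional
reduction (the GM₃ ∀L certificate, Level-2 row `N₁`); the rotor TARGET as originally worded stays FALSE (g15 verdict).
Mathlib + the tree only; no sorry.
-/

set_option linter.dupNamespace false
set_option autoImplicit false

open Literature.Analysis.ValidatedNumerics

namespace Summit.HubbardSuperconductivity.HubbardSuperconductivity.Theorems.AnisotropyChord.Transfer.Fibre3.L2.N1

variable (L : ℕ) [NeZero L] (Δ lam2 : ℝ) (f : Tor L → ℝ)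

/-- the repaired tail slope `κ̂′` (block `M₂ = 2`). -/
noncomputable def kapP : ℝ := kapHat L Δ lam2 f 2 + 2 * aPar L Δ f * cS L Δ lam2 f / (L : ℝ) ^ 2

/-- `Y(k) + P₂(k)` of `PC0OuterBound` with `κ̂′` and `m₀ = 13/10`. -/
noncomputable def YP2 (k : Tor L) : ℝ :=
  let κ := kapP L Δ lam2 f
  let τ := tauBar L Δ lam2 f
  let q := qPar L Δ f
  let β := betaK L Δ lam2 f k
  let g := gres L lam2 k
  (2 * β * κ * g * EK L k + τ * (β ^ 2 * EK L k / (13 / 10) + 2 * (13 / 10)) + 8 * q * κ * g + 4 * q * τ)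
    + (EK L k * κ ^ 2 * g ^ 2 + 2 * τ ^ 2)

/-- `|c(k)| + κ̂′g(k) = 2c_sg + d + κ̂′g`. -/
noncomputable def acZ (k : Tor L) : ℝ := 2 * cS L Δ lam2 f * gres L lam2 k + dPar L Δ f + kapP L Δ lam2 f * gres L lam2 k

/-! ## Single-sum reductions off the origin -/

/-- ★ `Σ_{k≠0} M(k) g(k) = M_g` (the `M_g` of `PC0ClosedExpansion`). -/
theorem sum_MK_gres (hlam : 0 < lam2) (h1 : lam2 < eps1 L) :
    let c := cS L Δ lam2 f
    let d := dPar L Δ f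
    let q := qPar L Δ f
    let V : ℝ := (L : ℝ) ^ 2
    ∑ k ∈ (Finset.univ : Finset (Tor L)).erase 0, MK L Δ lam2 f k * gres L lam2 k
      = 2 * (c ^ 2 * (S2n L lam2 + lam2 * S3n L lam2) + c * d * (S1n L lam2 + lam2 * S2n L lam2)
          + d ^ 2 / 4 * (V - 1 + lam2 * S1n L lam2)) + 4 * q ^ 2 * S1n L lam2 - q ^ 2 / 2 * (V - 1 + lam2 * S1n L lam2) := by
  intro c d q V
  have hL := ClosedExp.two_le_of_pos_lt_eps1 L hlam h1
  have hne : ∀ k : Tor L, k ≠ 0 → 2 * epsT L k - lam2 ≠ 0 := fun k hk => (ClosedExp.two_epsT_sub_pos' L hlam h1 k hk).ne'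
  have h : ∀ k ∈ (Finset.univ : Finset (Tor L)).erase 0, MK L Δ lam2 f k * gres L lam2 k
      = (d ^ 2 / 2 - q ^ 2 / 2)
        + (2 * c * d + d ^ 2 / 2 * lam2 - q ^ 2 / 2 * lam2 + 4 * q ^ 2) * gres L lam2 k
        + (2 * c * d * lam2 + 2 * c ^ 2) * gres L lam2 k ^ 2
        + (2 * c ^ 2 * lam2) * gres L lam2 k ^ 3 := by
    intro k hk
    have hk0 : k ≠ 0 := (Finset.mem_erase.1 hk).1
    have hE := KT1Assembly.two_epsT_mul_gres L lam2 k hk0 (hne k hk0)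
    unfold MK betaK EK
    linear_combination ((d ^ 2 / 2 - q ^ 2 / 2) + 2 * c * d * gres L lam2 k + 2 * c ^ 2 * gres L lam2 k ^ 2) * hE
  rw [Finset.sum_congr rfl h, Finset.sum_add_distrib, Finset.sum_add_distrib, Finset.sum_add_distrib,
    ← Finset.mul_sum, ← Finset.mul_sum, ← Finset.mul_sum, ClosedExp.sum_erase_zero_const,
    ClosedExp.sum_erase_zero L (fun k => gres L lam2 k), ClosedExp.sum_erase_zero L (fun k => gres L lam2 k ^ 2),
    ClosedExp.sum_erase_zero L (fun k => gres L lam2 k ^ 3), ClosedExp.gres_zero, ← S1n_eq, ← S2n_eq, ← S3n_eq]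
  ring

/-- ★ `Σ_{k≠0} (Y + P₂)(|c| + κ̂′g)` in named form (`Σ_{k≠0} E = 4V`, `E g^i = g^{i−1} + λ₂g^i`). -/
theorem sum_YP2 (hlam : 0 < lam2) (h1 : lam2 < eps1 L) :
    let c := cS L Δ lam2 f
    let d := dPar L Δ f
    let q := qPar L Δ f
    let κ := kapP L Δ lam2 f
    let τ := tauBar L Δ lam2 f
    let V : ℝ := (L : ℝ) ^ 2
    ∑ k ∈ (Finset.univ : Finset (Tor L)).erase 0, YP2 L Δ lam2 f k * acZ L Δ lam2 f k
      = (1 / 4 * d ^ 3 * (10 / 13) * τ) * (4 * V)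
        + (3 / 2 * c * d ^ 2 * (10 / 13) * τ + 2 * d * (13 / 10) * τ + 4 * d * q * τ + 2 * d * τ ^ 2
            + 1 / 4 * d ^ 2 * (10 / 13) * κ * τ + d ^ 2 * κ) * (V - 1)
        + (c * d * (10 / 13) * κ * τ + 4 * c * d * κ + 3 / 2 * c * d ^ 2 * (10 / 13) * lam2 * τ + 4 * c * (13 / 10) * τ
            + 8 * c * q * τ + 4 * c * τ ^ 2 + 3 * c ^ 2 * d * (10 / 13) * τ + 8 * d * q * κ + 2 * d * κ ^ 2
            + 1 / 4 * d ^ 2 * (10 / 13) * lam2 * κ * τ + d ^ 2 * lam2 * κ + 2 * (13 / 10) * κ * τ + 4 * q * κ * τ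
            + 2 * κ * τ ^ 2) * S1n L lam2
        + (c * d * (10 / 13) * lam2 * κ * τ + 4 * c * d * lam2 * κ + 16 * c * q * κ + 4 * c * κ ^ 2
            + 3 * c ^ 2 * d * (10 / 13) * lam2 * τ + c ^ 2 * (10 / 13) * κ * τ + 4 * c ^ 2 * κ + 2 * c ^ 3 * (10 / 13) * τ
            + 2 * d * lam2 * κ ^ 2 + 8 * q * κ ^ 2 + κ ^ 3) * S2n L lam2
        + (4 * c * lam2 * κ ^ 2 + c ^ 2 * (10 / 13) * lam2 * κ * τ + 4 * c ^ 2 * lam2 * κ + 2 * c ^ 3 * (10 / 13) * lam2 * τ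
            + lam2 * κ ^ 3) * S3n L lam2 := by
  intro c d q κ τ V
  have hL := ClosedExp.two_le_of_pos_lt_eps1 L hlam h1
  have hne : ∀ k : Tor L, k ≠ 0 → 2 * epsT L k - lam2 ≠ 0 := fun k hk => (ClosedExp.two_epsT_sub_pos' L hlam h1 k hk).ne'
  have h : ∀ k ∈ (Finset.univ : Finset (Tor L)).erase 0, YP2 L Δ lam2 f k * acZ L Δ lam2 f k
      = (1 / 4 * d ^ 3 * (10 / 13) * τ) * EK L k
        + (3 / 2 * c * d ^ 2 * (10 / 13) * τ + 2 * d * (13 / 10) * τ + 4 * d * q * τ + 2 * d * τ ^ 2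
            + 1 / 4 * d ^ 2 * (10 / 13) * κ * τ + d ^ 2 * κ)
        + (c * d * (10 / 13) * κ * τ + 4 * c * d * κ + 3 / 2 * c * d ^ 2 * (10 / 13) * lam2 * τ + 4 * c * (13 / 10) * τ
            + 8 * c * q * τ + 4 * c * τ ^ 2 + 3 * c ^ 2 * d * (10 / 13) * τ + 8 * d * q * κ + 2 * d * κ ^ 2
            + 1 / 4 * d ^ 2 * (10 / 13) * lam2 * κ * τ + d ^ 2 * lam2 * κ + 2 * (13 / 10) * κ * τ + 4 * q * κ * τ
            + 2 * κ * τ ^ 2) * gres L lam2 k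
        + (c * d * (10 / 13) * lam2 * κ * τ + 4 * c * d * lam2 * κ + 16 * c * q * κ + 4 * c * κ ^ 2
            + 3 * c ^ 2 * d * (10 / 13) * lam2 * τ + c ^ 2 * (10 / 13) * κ * τ + 4 * c ^ 2 * κ + 2 * c ^ 3 * (10 / 13) * τ
            + 2 * d * lam2 * κ ^ 2 + 8 * q * κ ^ 2 + κ ^ 3) * gres L lam2 k ^ 2
        + (4 * c * lam2 * κ ^ 2 + c ^ 2 * (10 / 13) * lam2 * κ * τ + 4 * c ^ 2 * lam2 * κ + 2 * c ^ 3 * (10 / 13) * lam2 * τ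
            + lam2 * κ ^ 3) * gres L lam2 k ^ 3 := by
    intro k hk
    have hk0 : k ≠ 0 := (Finset.mem_erase.1 hk).1
    have hE := KT1Assembly.two_epsT_mul_gres L lam2 k hk0 (hne k hk0)
    unfold YP2 acZ betaK EK
    dsimp only
    linear_combination ((3 / 2 * c * d ^ 2 * (10 / 13) * τ + 1 / 4 * d ^ 2 * (10 / 13) * κ * τ + d ^ 2 * κ)
      + (c * d * (10 / 13) * κ * τ + 4 * c * d * κ + 3 * c ^ 2 * d * (10 / 13) * τ + 2 * d * κ ^ 2) * gres L lam2 k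
      + (4 * c * κ ^ 2 + c ^ 2 * (10 / 13) * κ * τ + 4 * c ^ 2 * κ + 2 * c ^ 3 * (10 / 13) * τ + κ ^ 3) * gres L lam2 k ^ 2) * hE
  rw [Finset.sum_congr rfl h, Finset.sum_add_distrib, Finset.sum_add_distrib, Finset.sum_add_distrib, Finset.sum_add_distrib,
    ← Finset.mul_sum, ← Finset.mul_sum, ← Finset.mul_sum, ← Finset.mul_sum, ClosedExp.sum_erase_zero_const,
    ClosedExp.sum_erase_zero_EK L hL,
    ClosedExp.sum_erase_zero L (fun k => gres L lam2 k), ClosedExp.sum_erase_zero L (fun k => gres L lam2 k ^ 2),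
    ClosedExp.sum_erase_zero L (fun k => gres L lam2 k ^ 3), ClosedExp.gres_zero, ← S1n_eq, ← S2n_eq, ← S3n_eq]
  ring

/-! ## Hatted per-momentum values -/

/-- `M1 ↦ t·M(k)` on the grid. -/
theorem eval_M1 (hL : 5 ≤ L) (hΔ0 : 0 ≤ Δ) (hΔ1 : Δ < 1) (hf : IsGroundTwoMagnon L Δ lam2 f) (hlam : 0 < lam2)
    (h2 : 2 * lam2 < eps1 L) {q : ℤ × ℤ} (hq : q ∈ gridPts 3) :
    (M1 3 q).eval (xTrue L Δ lam2 f (Δ * f (K1 L))) = (2 * Real.pi / L) ^ 2 * MK L Δ lam2 f (B1.toTor L q) := by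
  set X := xTrue L Δ lam2 f (Δ * f (K1 L)) with hXdef
  obtain ⟨_, _, hb⟩ := eval_closed L Δ lam2 f hL hΔ0 hΔ1 hf hlam hq
  have hqq := eval_qq L Δ lam2 f hL hΔ0 hΔ1 hf
  have hE := eval_Eh L Δ lam2 f (by omega) hlam h2 hq (Δ * f (K1 L))
  have hX0 : X 0 = (2 * Real.pi / L) ^ 2 := xTrue_zero L Δ lam2 f _
  have hLpos : (0 : ℝ) < L := by exact_mod_cast (show 0 < L by omega)
  have hθ2 : (2 * Real.pi / (L : ℝ)) ^ 2 ≠ 0 := by positivity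
  have e1 : (M1 3 q).eval X = 2 * (bh 3 q).eval X ^ 2 * (Eh 3 q).eval X
      + 1 / 2 * qq.eval X ^ 2 * X 0 * (8 - X 0 * (Eh 3 q).eval X) := by
    simp only [M1, RExpr.eval, cst, vT]; push_cast; ring
  rw [e1, hb, hqq, hE, hX0]
  unfold MK EK
  field_simp

/-- `acx ↦ t(|c| + κ̂′g)` on the grid. -/
theorem eval_acx (hL : 12 ≤ L) (hΔ0 : 0 ≤ Δ) (hΔ1 : Δ < 1) (hf : IsGroundTwoMagnon L Δ lam2 f) (hlam : 0 < lam2)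
    (h2 : 2 * lam2 < eps1 L) (hu : 0 < cS L Δ lam2 f * Gzero L lam2) {q : ℤ × ℤ} (hq : q ∈ gridPts 3) :
    (acx 3 q).eval (xTrue L Δ lam2 f (Δ * f (K1 L))) = (2 * Real.pi / L) ^ 2 * acZ L Δ lam2 f (B1.toTor L q) := by
  obtain ⟨_, hac, _⟩ := eval_closed L Δ lam2 f (by omega) hΔ0 hΔ1 hf hlam hq
  have hk := kap_eval L Δ lam2 f hL hΔ0 hΔ1 hf hlam h2 hu
  have hG := eval_vG L Δ lam2 f hq (Δ * f (K1 L))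
  simp only [acx, RExpr.eval]
  rw [hac, hk, hG]
  unfold acZ kapP
  ring

/-- `YR1 ↦ t(Y + P₂)(k)` on the grid. -/
theorem eval_YR1 (hL : 12 ≤ L) (hΔ0 : 0 ≤ Δ) (hΔ1 : Δ < 1) (hf : IsGroundTwoMagnon L Δ lam2 f) (hlam : 0 < lam2)
    (h2 : 2 * lam2 < eps1 L) (hu : 0 < cS L Δ lam2 f * Gzero L lam2) {q : ℤ × ℤ} (hq : q ∈ gridPts 3) :
    (YR1 3 q).eval (xTrue L Δ lam2 f (Δ * f (K1 L))) = (2 * Real.pi / L) ^ 2 * YP2 L Δ lam2 f (B1.toTor L q) := by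
  set X := xTrue L Δ lam2 f (Δ * f (K1 L)) with hXdef
  obtain ⟨_, _, hb⟩ := eval_closed L Δ lam2 f (by omega) hΔ0 hΔ1 hf hlam hq
  have hqq := eval_qq L Δ lam2 f (by omega) hΔ0 hΔ1 hf
  have hE := eval_Eh L Δ lam2 f (by omega) hlam h2 hq (Δ * f (K1 L))
  have hk := kap_eval L Δ lam2 f hL hΔ0 hΔ1 hf hlam h2 hu
  have hG := eval_vG L Δ lam2 f hq (Δ * f (K1 L))
  have hτ := eval_taubar L Δ lam2 f (by omega) hΔ0 hΔ1 hf hlam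
  have hX0 : X 0 = (2 * Real.pi / L) ^ 2 := xTrue_zero L Δ lam2 f _
  have hLpos : (0 : ℝ) < L := by exact_mod_cast (show 0 < L by omega)
  have hθ2 : (2 * Real.pi / (L : ℝ)) ^ 2 ≠ 0 := by positivity
  have e1 : (YR1 3 q).eval X = 2 * kap.eval X * (bh 3 q).eval X * (vG 3 q).eval X * (Eh 3 q).eval X
      + taubar.eval X * (13 / 10 : ℝ)⁻¹ * (bh 3 q).eval X ^ 2 * (Eh 3 q).eval X
      + (2 * (13 / 10) + 4 * qq.eval X) * taubar.eval X * X 0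
      + 8 * qq.eval X * kap.eval X * (vG 3 q).eval X
      + kap.eval X ^ 2 * (vG 3 q).eval X ^ 2 * (Eh 3 q).eval X + 2 * X 0 * taubar.eval X ^ 2 := by
    simp only [YR1, m0, rsum, RExpr.eval, cst, vT]; push_cast; ring
  rw [e1, hb, hqq, hE, hk, hG, hτ, hX0]
  unfold YP2 kapP EK
  dsimp only
  field_simp
  ring

/-! ## Hatted full sums -/

/-- base coordinates of the true vector used by the full sums. -/
theorem xTrue_base (a : ℝ) :
    xTrue L Δ lam2 f a 0 = (2 * Real.pi / L) ^ 2 ∧ xTrue L Δ lam2 f a 1 = Real.pi ^ 2 ∧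
    xTrue L Δ lam2 f a 2 = lam2 / (2 * Real.pi / L) ^ 2 ∧
    xTrue L Δ lam2 f a 4 = (2 * Real.pi / L) ^ (2 * 2) * S2n L lam2 ∧
    xTrue L Δ lam2 f a 5 = (2 * Real.pi / L) ^ (2 * 3) * S3n L lam2 := by
  refine ⟨xTrue_zero L Δ lam2 f a, ?_, ?_, ?_, ?_⟩ <;> (rw [xTrue_lt16 L Δ lam2 f a (by norm_num)]; rfl)

/-- ★ `Q1closedFull ↦ t²·Σ_{k≠0} M(k)c(k)` (`PC0ClosedExpansion`). -/
theorem eval_Q1closedFull (hL : 5 ≤ L) (hΔ0 : 0 ≤ Δ) (hΔ1 : Δ < 1) (hf : IsGroundTwoMagnon L Δ lam2 f) (hlam : 0 < lam2)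
    (h1 : lam2 < eps1 L) (hu : 0 < cS L Δ lam2 f * Gzero L lam2) :
    Q1closedFull.eval (xTrue L Δ lam2 f (Δ * f (K1 L)))
      = ((2 * Real.pi / L) ^ 2) ^ 2 * ∑ k ∈ (Finset.univ : Finset (Tor L)).erase 0, MK L Δ lam2 f k * cK L Δ lam2 f k := by
  set X := xTrue L Δ lam2 f (Δ * f (K1 L)) with hXdef
  obtain ⟨_, dcs, _, ddd, _⟩ := dict_at_xTrue L Δ lam2 f hL hΔ0 hΔ1 hf hlam
  have hbase := xTrue_base L Δ lam2 f (Δ * f (K1 L))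
  rw [← hXdef] at hbase
  obtain ⟨hX0, hX1, hX2, hX4, hX5⟩ := hbase
  have hS1 : S1h.eval X = (2 * Real.pi / L) ^ 2 * S1n L lam2 := S1h_eval L Δ lam2 f hL hΔ0 hΔ1 hf hlam hu
  have hqq := eval_qq L Δ lam2 f hL hΔ0 hΔ1 hf
  have hLpos : (0 : ℝ) < L := by exact_mod_cast (show 0 < L by omega)
  have hexp := pc0ClosedExpansion_holds L Δ lam2 f hlam h1
  dsimp only at hexp
  rw [hexp]
  have e : Q1closedFull.eval X = -(4 * cs.eval X ^ 3 * (X 4 + X 2 * X 5)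
      + 6 * cs.eval X ^ 2 * dd.eval X * X 0 * (S1h.eval X + X 2 * X 4)
      + (3 * cs.eval X * dd.eval X ^ 2 - cs.eval X * qq.eval X ^ 2) * X 0 * (4 * X 1 - X 0 + X 2 * X 0 * S1h.eval X)
      + 8 * X 1 * X 0 * (dd.eval X ^ 3 - qq.eval X ^ 2 * dd.eval X)
      + 8 * cs.eval X * qq.eval X ^ 2 * X 0 * S1h.eval X
      + 4 * qq.eval X ^ 2 * dd.eval X * X 0 * (4 * X 1 - X 0)) := by
    simp only [Q1closedFull, sumGE, rsum, cube, RExpr.eval, cst, vS3, vS2, vT, vPi2, vNu]; push_cast; ring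
  rw [e, dcs, ddd, hqq, hX0, hX1, hX2, hX4, hX5, hS1]
  unfold dPar
  have hθ2 : (2 * Real.pi / (L : ℝ)) ^ 2 ≠ 0 := by positivity
  have hπ2 : Real.pi ^ 2 = (2 * Real.pi / (L : ℝ)) ^ 2 * (L : ℝ) ^ 2 / 4 := by
    field_simp
    ring
  rw [hπ2, pow_mul, pow_mul]
  field_simp
  ring

/-- ★ `vDfull ↦ t²·κ̂′·Σ_{k≠0} M(k)g(k)`. -/
theorem eval_vDfull (hL : 12 ≤ L) (hΔ0 : 0 ≤ Δ) (hΔ1 : Δ < 1) (hf : IsGroundTwoMagnon L Δ lam2 f) (hlam : 0 < lam2)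
    (h2 : 2 * lam2 < eps1 L) (hu : 0 < cS L Δ lam2 f * Gzero L lam2) :
    vDfull.eval (xTrue L Δ lam2 f (Δ * f (K1 L)))
      = ((2 * Real.pi / L) ^ 2) ^ 2 * (kapP L Δ lam2 f
          * ∑ k ∈ (Finset.univ : Finset (Tor L)).erase 0, MK L Δ lam2 f k * gres L lam2 k) := by
  set X := xTrue L Δ lam2 f (Δ * f (K1 L)) with hXdef
  obtain ⟨_, dcs, _, ddd, _⟩ := dict_at_xTrue L Δ lam2 f (by omega) hΔ0 hΔ1 hf hlam
  have hbase := xTrue_base L Δ lam2 f (Δ * f (K1 L))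
  rw [← hXdef] at hbase
  obtain ⟨hX0, hX1, hX2, hX4, hX5⟩ := hbase
  have hS1 : S1h.eval X = (2 * Real.pi / L) ^ 2 * S1n L lam2 := S1h_eval L Δ lam2 f (by omega) hΔ0 hΔ1 hf hlam hu
  have hqq := eval_qq L Δ lam2 f (by omega) hΔ0 hΔ1 hf
  have hk := kap_eval L Δ lam2 f hL hΔ0 hΔ1 hf hlam h2 hu
  have hLpos : (0 : ℝ) < L := by exact_mod_cast (show 0 < L by omega)
  have hsum := sum_MK_gres L Δ lam2 f hlam (by linarith)
  dsimp only at hsum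
  rw [hsum]
  have e : vDfull.eval X = kap.eval X * (2 * cs.eval X ^ 2 * (X 4 + X 2 * X 5)
      + 2 * cs.eval X * (dd.eval X * X 0) * (S1h.eval X + X 2 * X 4)
      + 1 / 2 * (dd.eval X ^ 2 - qq.eval X ^ 2) * X 0 * (4 * X 1 - X 0 + X 2 * X 0 * S1h.eval X)
      + 4 * qq.eval X ^ 2 * X 0 * S1h.eval X) := by
    simp only [vDfull, sumGE, Dt, rsum, RExpr.eval, cst, vS3, vS2, vT, vPi2, vNu]; push_cast; ring
  rw [e, hk, dcs, ddd, hqq, hX0, hX1, hX2, hX4, hX5, hS1]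
  unfold dPar kapP
  have hθ2 : (2 * Real.pi / (L : ℝ)) ^ 2 ≠ 0 := by positivity
  have hπ2 : Real.pi ^ 2 = (2 * Real.pi / (L : ℝ)) ^ 2 * (L : ℝ) ^ 2 / 4 := by
    field_simp
    ring
  rw [hπ2, pow_mul, pow_mul]
  field_simp
  ring

/-- ★ `vYfull ↦ t²·Σ_{k≠0} (Y + P₂)(|c| + κ̂′g)`. -/
theorem eval_vYfull (hL : 12 ≤ L) (hΔ0 : 0 ≤ Δ) (hΔ1 : Δ < 1) (hf : IsGroundTwoMagnon L Δ lam2 f) (hlam : 0 < lam2)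
    (h2 : 2 * lam2 < eps1 L) (hu : 0 < cS L Δ lam2 f * Gzero L lam2) :
    vYfull.eval (xTrue L Δ lam2 f (Δ * f (K1 L)))
      = ((2 * Real.pi / L) ^ 2) ^ 2 * ∑ k ∈ (Finset.univ : Finset (Tor L)).erase 0, YP2 L Δ lam2 f k * acZ L Δ lam2 f k := by
  set X := xTrue L Δ lam2 f (Δ * f (K1 L)) with hXdef
  obtain ⟨_, dcs, _, ddd, _⟩ := dict_at_xTrue L Δ lam2 f (by omega) hΔ0 hΔ1 hf hlam
  have hbase := xTrue_base L Δ lam2 f (Δ * f (K1 L))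
  rw [← hXdef] at hbase
  obtain ⟨hX0, hX1, hX2, hX4, hX5⟩ := hbase
  have hS1 : S1h.eval X = (2 * Real.pi / L) ^ 2 * S1n L lam2 := S1h_eval L Δ lam2 f (by omega) hΔ0 hΔ1 hf hlam hu
  have hqq := eval_qq L Δ lam2 f (by omega) hΔ0 hΔ1 hf
  have hk := kap_eval L Δ lam2 f hL hΔ0 hΔ1 hf hlam h2 hu
  have hτ := eval_taubar L Δ lam2 f (by omega) hΔ0 hΔ1 hf hlam
  have hLpos : (0 : ℝ) < L := by exact_mod_cast (show 0 < L by omega)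
  have hsum := sum_YP2 L Δ lam2 f hlam (by linarith)
  dsimp only at hsum
  rw [hsum]
  have e : vYfull.eval X =
      (2 * kap.eval X * cs.eval X + taubar.eval X * (13 / 10 : ℝ)⁻¹ * cs.eval X ^ 2 + kap.eval X ^ 2)
          * (2 * cs.eval X + kap.eval X) * (X 4 + X 2 * X 5)
      + ((2 * kap.eval X * cs.eval X + taubar.eval X * (13 / 10 : ℝ)⁻¹ * cs.eval X ^ 2 + kap.eval X ^ 2) * (dd.eval X * X 0)
          + (kap.eval X * (dd.eval X * X 0) + taubar.eval X * (13 / 10 : ℝ)⁻¹ * cs.eval X * (dd.eval X * X 0))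
            * (2 * cs.eval X + kap.eval X)) * (S1h.eval X + X 2 * X 4)
      + (kap.eval X * dd.eval X ^ 2 + taubar.eval X * (13 / 10 : ℝ)⁻¹ * cs.eval X * dd.eval X ^ 2
          + taubar.eval X * (13 / 10 : ℝ)⁻¹ * dd.eval X ^ 2 * (1 / 4) * (2 * cs.eval X + kap.eval X)) * X 0
          * (4 * X 1 - X 0 + X 2 * X 0 * S1h.eval X)
      + 4 * X 1 * X 0 * (taubar.eval X * (13 / 10 : ℝ)⁻¹) * dd.eval X ^ 3
      + (X 0 * ((2 * (13 / 10) + 4 * qq.eval X) * taubar.eval X + 2 * taubar.eval X ^ 2) * (2 * cs.eval X + kap.eval X)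
          + 8 * qq.eval X * kap.eval X * (dd.eval X * X 0)) * S1h.eval X
      + ((2 * (13 / 10) + 4 * qq.eval X) * taubar.eval X + 2 * taubar.eval X ^ 2) * dd.eval X * X 0 * (4 * X 1 - X 0)
      + 8 * qq.eval X * kap.eval X * (2 * cs.eval X + kap.eval X) * X 4 := by
    simp only [vYfull, cA, cB, cE0, cG, c2, m0, sumGE, Dt, rsum, cube, RExpr.eval, cst, vS3, vS2, vT, vPi2, vNu]
    push_cast; ring
  rw [e, hk, dcs, ddd, hqq, hτ, hX0, hX1, hX2, hX4, hX5, hS1]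
  unfold dPar kapP
  have hθ2 : (2 * Real.pi / (L : ℝ)) ^ 2 ≠ 0 := by positivity
  have hπ2 : Real.pi ^ 2 = (2 * Real.pi / (L : ℝ)) ^ 2 * (L : ℝ) ^ 2 / 4 := by
    field_simp
    ring
  rw [hπ2, pow_mul, pow_mul]
  field_simp
  ring

end Summit.HubbardSuperconductivity.HubbardSuperconductivity.Theorems.AnisotropyChord.Transfer.Fibre3.L2.N1
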